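import Literature.NumberTheory.Irrationality.Zudilin2002.WellPoisedForms
import HarnessLib

/-!
# ζ(5) search — row 7: the minors of (15) solve Zudilin's recursion (1), from (8) and the partner contiguity (cell `pub-zeta5`)

HONEST FRAMING: systematic search; no irrationality claim unless certified.

OUR work (Summit side; lead/lit g3, `HOME/pub-zeta5-lit-g3/MINORS-ROUTE.md`). Zudilin (Mat. Zametki 2002, Sect. 2) defines
`qₙ, pₙ, p̃ₙ` by (15) as the 2×2 minors of the coefficient vectors `Xₙ = (uₙ, wₙ, vₙ)`, `X̃ₙ = (ũₙ, w̃ₙ, ṽₙ)` of the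
very-well-poised forms `rₙ, r̃ₙ` (tree: `Literature/…/Zudilin2002/WellPoisedForms`: `uC … vtC`, `minorQ/minorP/minorPt`) and
states that they satisfy the recursion (1). This file isolates the ALGEBRA of that claim from its two hypergeometric inputs:

* `Rec8 x` — Zudilin's auxiliary recursion (8) (his Theorem 2) for a scalar sequence, written at the index `n = m + 2`
  with the four polynomial coefficients `P3 m, P2 m, P1 m, P0 m`; INPUT, to be discharged for `uC, wC, vC` by the
  pf-transfer of the cell's kernel-certified `t`-telescoper `SymRayGosper.gosper_symray` (whose telescoper IS (8), gauged);
* `Contig x xt` — the cell's PARTNER CONTIGUITY (found by exact computation, MINORS-ROUTE step (ii); to be certified the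
  same way): `b₀(n)·x̃ₙ = −196n⁵·xₙ₋₁ + 3(10130n⁵+19198n⁴+16675n³+8207n²+2233n+261)·xₙ − 87(n+1)⁵·xₙ₊₁` (`n ≥ 1`),
  `b₀(n) = −a₀(−n) = 41218n³ + 48459n² + 20010n + 2871`;

and PROVES: (a) `minor_eq`: `b₀(k)·(x_k ỹ_k − x̃_k y_k) = 196k⁵·d_{k−1} − 87(k+1)⁵·d_k` with the Casoratian
`d_k = x_k y_{k+1} − x_{k+1} y_k`; (b) `cas_rec`: the exterior square of (8) — a third-order recursion for `d` (generic in
the coefficients); (c) `minor_rec`: hence the minor satisfies (1) at every index `n ≥ 3` (after the substitutions, ONE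
polynomial identity in `n`, closed by `ring`); (d) `minors_isSolution`: for `(uC,wC,vC)`, `(utC,wtC,vtC)` the index
`n = 2` holds by the values at `n ≤ 3` (`eq15_zero_one`, `eq15_two`, `eq15_three`), so
`IsSolution minorQ ∧ IsSolution minorP ∧ IsSolution minorPt`; (e) `tendsto_of_rec8_of_contig`: with lit's
`tendsto_of_minors_isSolution` — **`pₙ/qₙ → ζ(5)` and `p̃ₙ/qₙ → ζ(3)` follow from `Rec8`×3 + `Contig`×3 + `Q_solvesRec`**.
-/

noncomputable section

open Filter
open scoped Topology

namespace Summit.KontsevichZagierPeriods.Zeta5Search.Zudilin2002Minors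

open Literature.NumberTheory.Irrationality.Zudilin2002
open Literature.NumberTheory.Irrationality (BrownZudilin2022.Q_solvesRec)
open Literature.NumberTheory.Transcendental (zetaValue)

/-! ### The coefficients of (8) and of the contiguity -/

/-- `b₀(n) = −a₀(−n)`. -/
def b₀ (n : ℚ) : ℚ := -a₀ (-n)

/-- `b₁(n) = a₂(−n)`. -/
def b₁ (n : ℚ) : ℚ := a₂ (-n)

/-- `b₂(n) = −a₁(−n)`. -/
def b₂ (n : ℚ) : ℚ := -a₁ (-n)

/-- `b₀(n) = 41218n³ + 48459n² + 20010n + 2871`. -/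
theorem b₀_eq (n : ℚ) : b₀ n = 41218 * n ^ 3 + 48459 * n ^ 2 + 20010 * n + 2871 := by
  simp only [b₀, a₀]; ring

/-- `b₀(n) > 0` for `n ≥ 0`. -/
theorem b₀_pos {n : ℚ} (hn : 0 ≤ n) : 0 < b₀ n := by
  rw [b₀_eq]; positivity

/-- Coefficient of `x_{n+1}` in (8) at `n = m+2`: `n(n+1)⁵b₀(n−1)`. -/
def P3 (m : ℕ) : ℚ := ((m : ℚ) + 2) * ((m : ℚ) + 3) ^ 5 * b₀ ((m : ℚ) + 1)

/-- Coefficient of `x_n` in (8) at `n = m+2` (moved to the right): `2n b₁(n)`. -/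
def P2 (m : ℕ) : ℚ := 2 * ((m : ℚ) + 2) * b₁ ((m : ℚ) + 2)

/-- Coefficient of `x_{n−1}` in (8) at `n = m+2` (moved to the right): `b₂(n)`. -/
def P1 (m : ℕ) : ℚ := b₂ ((m : ℚ) + 2)

/-- Coefficient of `x_{n−2}` in (8) at `n = m+2`: `2(n−1)⁵(2n−1)b₀(n)`. -/
def P0 (m : ℕ) : ℚ := 2 * ((m : ℚ) + 1) ^ 5 * (2 * ((m : ℚ) + 2) - 1) * b₀ ((m : ℚ) + 2)

/-- Zudilin's recursion (8) for a scalar sequence, at the index `n = m + 2` (all `m : ℕ`):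
`n(n+1)⁵b₀(n−1)·x_{n+1} − 2n b₁(n)·x_n − b₂(n)·x_{n−1} + 2(n−1)⁵(2n−1)b₀(n)·x_{n−2} = 0`. -/
def Rec8 (x : ℕ → ℚ) : Prop := ∀ m : ℕ, P3 m * x (m + 3) - P2 m * x (m + 2) - P1 m * x (m + 1) + P0 m * x m = 0

/-- `b₀(n)` at `n = m + 1`. -/
def Q0 (m : ℕ) : ℚ := b₀ ((m : ℚ) + 1)

/-- `−196 n⁵` at `n = m + 1`. -/
def QA (m : ℕ) : ℚ := -196 * ((m : ℚ) + 1) ^ 5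

/-- `3(10130n⁵ + 19198n⁴ + 16675n³ + 8207n² + 2233n + 261)` at `n = m + 1`. -/
def QB (m : ℕ) : ℚ := 3 * (10130 * ((m : ℚ) + 1) ^ 5 + 19198 * ((m : ℚ) + 1) ^ 4 + 16675 * ((m : ℚ) + 1) ^ 3
  + 8207 * ((m : ℚ) + 1) ^ 2 + 2233 * ((m : ℚ) + 1) + 261)

/-- `−87 (n+1)⁵` at `n = m + 1`. -/
def QC (m : ℕ) : ℚ := -87 * ((m : ℚ) + 2) ^ 5

/-- The cell's PARTNER CONTIGUITY at the index `n = m + 1` (all `m : ℕ`):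
`b₀(n)·x̃_n = −196 n⁵·x_{n−1} + 3(10130n⁵+…+261)·x_n − 87 (n+1)⁵·x_{n+1}`. -/
def Contig (x xt : ℕ → ℚ) : Prop := ∀ m : ℕ, Q0 m * xt (m + 1) = QA m * x m + QB m * x (m + 1) + QC m * x (m + 2)

/-- The Casoratian of consecutive vectors: `d_k = x_k y_{k+1} − x_{k+1} y_k`. -/
def cas (x y : ℕ → ℚ) (k : ℕ) : ℚ := x k * y (k + 1) - x (k + 1) * y k

/-- The minor of (15): `m_k = x_k ỹ_k − x̃_k y_k`. -/
def minor (x y xt yt : ℕ → ℚ) (k : ℕ) : ℚ := x k * yt k - xt k * y k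

/-- `P3 m ≠ 0`. -/
theorem P3_ne_zero (m : ℕ) : P3 m ≠ 0 := by
  have := b₀_pos (show (0 : ℚ) ≤ (m : ℚ) + 1 by positivity)
  unfold P3; positivity

/-- `Q0 m ≠ 0`. -/
theorem Q0_ne_zero (m : ℕ) : Q0 m ≠ 0 :=
  (b₀_pos (show (0 : ℚ) ≤ (m : ℚ) + 1 by positivity)).ne'

/-! ### (a) the minor through Casoratians -/

/-- `b₀(k)·m_k = 196 k⁵ d_{k−1} − 87 (k+1)⁵ d_k`, i.e. `Q0 m · m_{m+1} = −QA m · d_m + QC m · d_{m+1}`. -/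
theorem minor_eq {x y xt yt : ℕ → ℚ} (hxt : Contig x xt) (hyt : Contig y yt) (m : ℕ) :
    minor x y xt yt (m + 1) = (-QA m * cas x y m + QC m * cas x y (m + 1)) / Q0 m := by
  rw [eq_div_iff (Q0_ne_zero m)]
  have h1 := hxt m
  have h2 := hyt m
  simp only [minor, cas]
  linear_combination x (m + 1) * h2 - y (m + 1) * h1

/-! ### (b) the exterior square of (8) (generic in the coefficients) -/

/-- (8) solved for the top term. -/
theorem Rec8.top {x : ℕ → ℚ} (hx : Rec8 x) (m : ℕ) :
    x (m + 3) = (P2 m * x (m + 2) + P1 m * x (m + 1) - P0 m * x m) / P3 m := by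
  rw [eq_div_iff (P3_ne_zero m)]
  linear_combination hx m

/-- **Exterior square of (8)**: for two solutions `x, y`, the Casoratians satisfy
`P3(m+1)P3(m)·d_{m+3} = −P1(m+1)P3(m)·d_{m+2} + P0(m+1)P2(m)·d_{m+1} + P0(m+1)P0(m)·d_m`. -/
theorem cas_rec {x y : ℕ → ℚ} (hx : Rec8 x) (hy : Rec8 y) (m : ℕ) :
    cas x y (m + 3) = (-(P1 (m + 1) * P3 m) * cas x y (m + 2) + P0 (m + 1) * P2 m * cas x y (m + 1)
      + P0 (m + 1) * P0 m * cas x y m) / (P3 (m + 1) * P3 m) := by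
  have hx4 := hx.top (m + 1)
  have hy4 := hy.top (m + 1)
  rw [show (m + 1 + 3 : ℕ) = m + 4 from rfl, show (m + 1 + 2 : ℕ) = m + 3 from rfl,
    show (m + 1 + 1 : ℕ) = m + 2 from rfl] at hx4 hy4
  have hx3 := hx.top m
  have hy3 := hy.top m
  have h0 := P3_ne_zero m
  have h1 := P3_ne_zero (m + 1)
  rw [eq_div_iff (mul_ne_zero h1 h0)]
  simp only [cas]
  rw [show (m + 3 + 1 : ℕ) = m + 4 from rfl, show (m + 2 + 1 : ℕ) = m + 3 from rfl,
    show (m + 1 + 1 : ℕ) = m + 2 from rfl, hx4, hy4, hx3, hy3]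
  field_simp
  ring

/-! ### (c) the minor satisfies (1) for `n ≥ 3` -/

/-- **The minor solves Zudilin's (1) at every index `n = m + 3`**:
`(n+1)⁶a₀(n)m_{n+1} + a₁(n)m_n − 4(2n−1)a₂(n)m_{n−1} − 4(n−1)⁴(2n−1)(2n−3)a₀(n+1)m_{n−2} = 0`. -/
theorem minor_rec {x y xt yt : ℕ → ℚ} (hx : Rec8 x) (hy : Rec8 y) (hxt : Contig x xt) (hyt : Contig y yt)
    (m : ℕ) :
    ((m : ℚ) + 4) ^ 6 * a₀ ((m : ℚ) + 3) * minor x y xt yt (m + 4) + a₁ ((m : ℚ) + 3) * minor x y xt yt (m + 3)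
      - 4 * (2 * ((m : ℚ) + 3) - 1) * a₂ ((m : ℚ) + 3) * minor x y xt yt (m + 2)
      - 4 * ((m : ℚ) + 2) ^ 4 * (2 * ((m : ℚ) + 3) - 1) * (2 * ((m : ℚ) + 3) - 3) * a₀ ((m : ℚ) + 4)
        * minor x y xt yt (m + 1) = 0 := by
  have e4 := minor_eq hxt hyt (m + 3)
  have e3 := minor_eq hxt hyt (m + 2)
  have e2 := minor_eq hxt hyt (m + 1)
  have e1 := minor_eq hxt hyt m
  rw [show (m + 3 + 1 : ℕ) = m + 4 from rfl] at e4
  rw [show (m + 2 + 1 : ℕ) = m + 3 from rfl] at e3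
  rw [show (m + 1 + 1 : ℕ) = m + 2 from rfl] at e2
  have c4 := cas_rec hx hy (m + 1)
  rw [show (m + 1 + 3 : ℕ) = m + 4 from rfl, show (m + 1 + 2 : ℕ) = m + 3 from rfl,
    show (m + 1 + 1 : ℕ) = m + 2 from rfl] at c4
  have c3 := cas_rec hx hy m
  have hq0 := Q0_ne_zero m
  have hq1 := Q0_ne_zero (m + 1)
  have hq2 := Q0_ne_zero (m + 2)
  have hq3 := Q0_ne_zero (m + 3)
  have hp0 := P3_ne_zero m
  have hp1 := P3_ne_zero (m + 1)
  have hp2 := P3_ne_zero (m + 2)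
  rw [e4, e3, e2, e1, c4, c3]
  field_simp
  simp only [P0, P1, P2, P3, Q0, QA, QC, b₀, b₁, b₂, a₀, a₁, a₂]
  push_cast
  ring

/-! ### (d) the three minors of (15) solve (1) -/

/-- (1) at the index `n = m + 3` for a concrete sequence, from `minor_rec` (sign `ε = ±1`). -/
private theorem isSolution_aux {f : ℕ → ℚ} {x y xt yt : ℕ → ℚ} (ε : ℚ) (hf : ∀ k, f k = ε * minor x y xt yt k)
    (hx : Rec8 x) (hy : Rec8 y) (hxt : Contig x xt) (hyt : Contig y yt)
    (h2 : ((2 : ℚ) + 1) ^ 6 * a₀ (2 : ℚ) * f 3 + a₁ (2 : ℚ) * f 2 - 4 * (2 * (2 : ℚ) - 1) * a₂ (2 : ℚ) * f 1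
      - 4 * ((2 : ℚ) - 1) ^ 4 * (2 * (2 : ℚ) - 1) * (2 * (2 : ℚ) - 3) * a₀ ((2 : ℚ) + 1) * f 0 = 0) :
    IsSolution f := by
  intro n hn
  obtain ⟨m, rfl⟩ : ∃ m, n = m + 2 := ⟨n - 2, by omega⟩
  rcases m with _ | m
  · simpa using h2
  · have h := minor_rec hx hy hxt hyt m
    rw [show (m + 1 + 2 + 1 : ℕ) = m + 4 by omega, show (m + 1 + 2 : ℕ) = m + 3 by omega,
      show (m + 3 - 1 : ℕ) = m + 2 by omega, show (m + 3 - 2 : ℕ) = m + 1 by omega, hf, hf, hf, hf]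
    push_cast
    simp only [a₀, a₁, a₂] at h ⊢
    linear_combination ε * h

/-- **The three minors of (15) solve Zudilin's recursion (1)**, given (8) for `u, w, v` and the partner contiguity for
`ũ, w̃, ṽ` (the index `n = 2` by the explicit values at `n ≤ 3` of `WellPoisedForms`). -/
theorem minors_isSolution (hu : Rec8 uC) (hw : Rec8 wC) (hv : Rec8 vC) (hut : Contig uC utC)
    (hwt : Contig wC wtC) (hvt : Contig vC vtC) :
    IsSolution minorQ ∧ IsSolution minorP ∧ IsSolution minorPt := by
  obtain ⟨g0u, g0w, g0v, g0ut, g0wt, g0vt⟩ := values_zero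
  obtain ⟨g1u, g1w, g1v, g1ut, g1wt, g1vt⟩ := values_one
  obtain ⟨g2u, g2w, g2v, g2ut, g2wt, g2vt⟩ := values_two
  obtain ⟨g3u, g3w, g3v, g3ut, g3wt, g3vt⟩ := values_three
  refine ⟨?_, ?_, ?_⟩
  · refine isSolution_aux 1 (fun k => by simp [minorQ, minor]) hu hw hut hwt ?_
    simp only [minorQ, g0u, g0w, g0ut, g0wt, g1u, g1w, g1ut, g1wt, g2u, g2w, g2ut, g2wt, g3u, g3w, g3ut, g3wt, a₀, a₁, a₂]
    norm_num
  · refine isSolution_aux (-1) (fun k => by simp [minorP, minor]) hw hv hwt hvt ?_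
    simp only [minorP, g0w, g0v, g0wt, g0vt, g1w, g1v, g1wt, g1vt, g2w, g2v, g2wt, g2vt, g3w, g3v, g3wt, g3vt, a₀, a₁, a₂]
    norm_num
  · refine isSolution_aux 1 (fun k => by simp [minorPt, minor]) hu hv hut hvt ?_
    simp only [minorPt, g0u, g0v, g0ut, g0vt, g1u, g1v, g1ut, g1vt, g2u, g2v, g2ut, g2vt, g3u, g3v, g3ut, g3vt, a₀, a₁, a₂]
    norm_num

/-! ### (e) the two identifications -/

/-- **Row 7's two limits from the two hypergeometric inputs**: if `(u, w, v)` of Zudilin's `rₙ` satisfy (8) and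
`(ũ, w̃, ṽ)` of `r̃ₙ` satisfy the partner contiguity, then (with `Q_solvesRec`, discharged in the tree)
`pₙ/qₙ → ζ(5)` and `p̃ₙ/qₙ → ζ(3)`. -/
theorem tendsto_of_rec8_of_contig (hQ : BrownZudilin2022.Q_solvesRec) (hu : Rec8 uC) (hw : Rec8 wC) (hv : Rec8 vC)
    (hut : Contig uC utC) (hwt : Contig wC wtC) (hvt : Contig vC vtC) :
    Tendsto (fun n : ℕ => (p n : ℝ) / q n) atTop (𝓝 (zetaValue 5)) ∧
      Tendsto (fun n : ℕ => (ptilde n : ℝ) / q n) atTop (𝓝 (zetaValue 3)) := by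
  obtain ⟨h1, h2, h3⟩ := minors_isSolution hu hw hv hut hwt hvt
  exact tendsto_of_minors_isSolution hQ h1 h2 h3

end Summit.KontsevichZagierPeriods.Zeta5Search.Zudilin2002Minors
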